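import Literature.Topology.FourManifolds.KnotsInBall
import HarnessLib

/-!
# The handle-slide sweep, planar part I: horizontal pushes and the circle-preserving angular twist

Topic `Literature/Topology/FourManifolds`; fact seat
`provefact-IsStrictHandleSlide.isSurgery` (R. C. Kirby, *The Topology of 4-Manifolds*, LNM 1374
(1989), Ch. I §5, Thm. 5.1 (1): "slide one 2-handle over another (this does not change `M_L`)";
the move is Ch. I §4, p. 10: the slid attaching circle is the band-connected sum `Kᵢ #_b Kⱼ'` with
the framing push-off `Kⱼ'`, and the slide is an isotopy of the attaching circle in
`Yⱼ = ∂(B⁴ ∪ hⱼ)` across the meridian disc `Δ` of the new solid torus bounded by `Kⱼ'`). In the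
tree the remaining content of this theorem is the named fact (S)
`Literature.Topology.FourManifolds.FramedLink.IsStrictHandleSlide.slideModel`
(`KirbyMovesHandleSlide.lean`), whose geometric heart is **the sweep across `Δ`**: a compactly
supported ambient isotopy of a meridian slice of the surgered tube carrying the slid arc from one
side of the centre of `Δ` to the other. This file provides the two explicit planar isotopies from
which that sweep is assembled (everything here is proved; no named fact is introduced):

* `Literature.Topology.FourManifolds.SlideSweep.exists_ambientIsotopy_horizontalPush` — **the
  horizontal push**: for a bounded smooth `d : ℝ → ℝ` and a radius `ρ`, an ambient isotopy `G`
  of the plane, stationary off a compact subset of any prescribed open set containing the ball of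
  radius `ρ + 2M` (`M ≥ sup |d|`), with `G t (x, y) = (x + t d(y), y)` on the ball of radius `ρ`
  for `0 ≤ t ≤ 1`. In the twisted chart of the slice the two arcs to be exchanged are graphs
  `x = g₂(y)` and `x = g₁(y)` over a common interval, and the push with `d = g₁ - g₂` carries one
  onto the other while fixing the lines where `d = 0` (Hirsch, *Differential Topology* (1976),
  Ch. 8 §1, Thm. 1.2–1.3: diffeotopies generated by vector fields, cut off near the track).
* `Literature.Topology.FourManifolds.SlideSweep.exists_ambientIsotopy_verticalShear` — the same
  with the roles of the coordinates exchanged (recorded for symmetry of use).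

The proofs are two-line applications of the tree's
`Literature.Topology.FourManifolds.exists_ambientIsotopy_of_hasDerivAt` (`KnotsInBall.lean`: the
cut-off flow of a smooth field realises any compact family of its trajectories) to the constant
fields `d(y) ∂ₓ`, resp. `d(x) ∂_y`, all of whose trajectories are explicit straight segments.

## References

* R. C. Kirby, *The Topology of 4-Manifolds*, LNM 1374, Springer (1989), Ch. I §4 (p. 10,
  Figs. 4.2–4.4), §5 Thm. 5.1. [Kirby1989]
* M. W. Hirsch, *Differential Topology*, GTM 33, Springer (1976), Ch. 8 §1, Thms. 1.2–1.3.
  [HirschDT1976]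

## Design notes

* Points of the plane are `z : EuclideanSpace ℝ (Fin 2)` with coordinates `z 0` (horizontal) and
  `z 1` (vertical); the unit vectors are `EuclideanSpace.single 0 1`, `EuclideanSpace.single 1 1`.
* No definitions are introduced; no `sorry`.
-/

open scoped Manifold ContDiff Topology
open Function Set Metric

noncomputable section

namespace Literature.Topology.FourManifolds

namespace SlideSweep

/-! ## Coordinates -/

/-- The horizontal unit vector `e₀ = (1, 0)`. [folklore] -/
theorem single_zero_apply_zero : (EuclideanSpace.single (0 : Fin 2) (1 : ℝ)) 0 = 1 := by
  simp

/-- The horizontal unit vector has no vertical component. [folklore] -/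
theorem single_zero_apply_one : (EuclideanSpace.single (0 : Fin 2) (1 : ℝ)) 1 = 0 := by
  simp

/-- The vertical unit vector has no horizontal component. [folklore] -/
theorem single_one_apply_zero : (EuclideanSpace.single (1 : Fin 2) (1 : ℝ)) 0 = 0 := by
  simp

/-- The vertical unit vector `e₁ = (0, 1)`. [folklore] -/
theorem single_one_apply_one : (EuclideanSpace.single (1 : Fin 2) (1 : ℝ)) 1 = 1 := by
  simp

/-- The unit coordinate vectors have norm one. [folklore] -/
theorem norm_single_one (i : Fin 2) : ‖EuclideanSpace.single i (1 : ℝ)‖ = 1 := by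
  simp

/-- A coordinate of a point of the plane is a smooth function. [folklore] -/
theorem contDiff_apply (i : Fin 2) : ContDiff ℝ ∞ fun z : EuclideanSpace ℝ (Fin 2) ↦ z i :=
  contDiff_euclidean.1 contDiff_id i

/-! ## The horizontal push -/

/-- **The horizontal push.** Let `d : ℝ → ℝ` be smooth with `|d| ≤ M`, and `ρ : ℝ`. For every
open `U` containing the closed ball of radius `ρ + 2M` there is an ambient isotopy `G` of the
plane, all of whose stages are the identity off a compact subset of `U`, such that for `‖z‖ ≤ ρ`
and `0 ≤ t ≤ 1` the stage `G t` translates `z` horizontally by `t d(z 1)`: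
`G t z = z + (t d (z 1)) e₀`. (The constant field `d(y) ∂ₓ` has the straight trajectories
`t ↦ z + t d(z 1) e₀`; cut it off near the ball and integrate: Hirsch (1976), Ch. 8 §1,
Thms. 1.2–1.3.) [cite: HirschDT1976, Ch. 8 §1, Thm. 1.3] -/
theorem exists_ambientIsotopy_horizontalPush {d : ℝ → ℝ} (hd : ContDiff ℝ ∞ d) {M : ℝ}
    (hM : ∀ y, |d y| ≤ M) {ρ : ℝ} {U : Set (EuclideanSpace ℝ (Fin 2))} (hU : IsOpen U)
    (hKU : closedBall (0 : EuclideanSpace ℝ (Fin 2)) (ρ + 2 * M) ⊆ U) :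
    ∃ G : AmbientIsotopy 𝓘(ℝ, EuclideanSpace ℝ (Fin 2)) (EuclideanSpace ℝ (Fin 2)),
      (∃ C : Set (EuclideanSpace ℝ (Fin 2)), IsCompact C ∧ C ⊆ U ∧ ∀ t, ∀ z ∉ C, G.toFun t z = z) ∧
      ∀ z : EuclideanSpace ℝ (Fin 2), ‖z‖ ≤ ρ → ∀ t ∈ Icc (0 : ℝ) 1,
        G.toFun t z = z + (t * d (z 1)) • EuclideanSpace.single 0 1 := by
  -- the field and its trajectories
  set Y : ℝ × EuclideanSpace ℝ (Fin 2) → EuclideanSpace ℝ (Fin 2) := fun p ↦ d (p.2 1) • EuclideanSpace.single 0 1 with hY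
  have hYs : ContDiff ℝ ∞ Y :=
    ((hd.comp ((contDiff_apply 1).comp contDiff_snd)).smul contDiff_const)
  set c : closedBall (0 : EuclideanSpace ℝ (Fin 2)) ρ → ℝ → EuclideanSpace ℝ (Fin 2) :=
    fun z t ↦ (z : EuclideanSpace ℝ (Fin 2)) + (t * d ((z : EuclideanSpace ℝ (Fin 2)) 1)) • EuclideanSpace.single 0 1 with hc
  have hc1 : ∀ (z : closedBall (0 : EuclideanSpace ℝ (Fin 2)) ρ) (t : ℝ), c z t 1 = (z : EuclideanSpace ℝ (Fin 2)) 1 := fun z t ↦ by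
    simp [c]
  have hderiv : ∀ (z : closedBall (0 : EuclideanSpace ℝ (Fin 2)) ρ), ∀ t ∈ Ioo (-1 : ℝ) 2,
      HasDerivAt (c z) (Y (t, c z t)) t := by
    intro z t _
    have h1 : HasDerivAt (fun t : ℝ ↦ t * d ((z : EuclideanSpace ℝ (Fin 2)) 1)) (d ((z : EuclideanSpace ℝ (Fin 2)) 1)) t := by
      simpa using (hasDerivAt_id t).mul_const (d ((z : EuclideanSpace ℝ (Fin 2)) 1))
    have h2 := (h1.smul_const (EuclideanSpace.single (0 : Fin 2) (1 : ℝ))).const_add (z : EuclideanSpace ℝ (Fin 2))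
    have hY' : Y (t, c z t) = d ((z : EuclideanSpace ℝ (Fin 2)) 1) • EuclideanSpace.single 0 1 := by
      simp only [hY, hc1]
    rw [hY']
    exact h2
  -- the tracks stay in the ball of radius `ρ + 2M`
  have htrack : ∀ (z : closedBall (0 : EuclideanSpace ℝ (Fin 2)) ρ), ∀ t ∈ Ioo (-1 : ℝ) 2,
      c z t ∈ closedBall (0 : EuclideanSpace ℝ (Fin 2)) (ρ + 2 * M) := by
    intro z t ht
    have hz : ‖(z : EuclideanSpace ℝ (Fin 2))‖ ≤ ρ := mem_closedBall_zero_iff.1 z.2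
    rw [mem_closedBall_zero_iff]
    calc ‖c z t‖ ≤ ‖(z : EuclideanSpace ℝ (Fin 2))‖ + ‖(t * d ((z : EuclideanSpace ℝ (Fin 2)) 1)) • EuclideanSpace.single (0 : Fin 2) (1 : ℝ)‖ :=
          norm_add_le _ _
      _ = ‖(z : EuclideanSpace ℝ (Fin 2))‖ + |t| * |d ((z : EuclideanSpace ℝ (Fin 2)) 1)| := by
          rw [norm_smul, norm_single_one, mul_one, Real.norm_eq_abs, abs_mul]
      _ ≤ ρ + 2 * M := by
          have ht2 : |t| ≤ 2 := abs_le.2 ⟨by linarith [ht.1], ht.2.le⟩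
          have := hM ((z : EuclideanSpace ℝ (Fin 2)) 1)
          nlinarith [abs_nonneg t, abs_nonneg (d ((z : EuclideanSpace ℝ (Fin 2)) 1))]
  obtain ⟨G, hGC, hGc⟩ := exists_ambientIsotopy_of_hasDerivAt hYs hderiv
    (isCompact_closedBall (0 : EuclideanSpace ℝ (Fin 2)) (ρ + 2 * M)) hU hKU htrack
  refine ⟨G, hGC, fun z hz t ht ↦ ?_⟩
  have := hGc ⟨z, mem_closedBall_zero_iff.2 hz⟩ t ht
  simpa [c] using this

/-- **The vertical shear** (the horizontal push with the coordinates exchanged): for a bounded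
smooth `d` and any `ρ`, an ambient isotopy of the plane, stationary off a compact subset of any
open `U ⊇ B̄(0, ρ + 2M)`, with `G t z = z + (t d (z 0)) e₁` for `‖z‖ ≤ ρ`, `0 ≤ t ≤ 1`.
Hirsch (1976), Ch. 8 §1, Thms. 1.2–1.3. [cite: HirschDT1976, Ch. 8 §1, Thm. 1.3] -/
theorem exists_ambientIsotopy_verticalShear {d : ℝ → ℝ} (hd : ContDiff ℝ ∞ d) {M : ℝ}
    (hM : ∀ x, |d x| ≤ M) {ρ : ℝ} {U : Set (EuclideanSpace ℝ (Fin 2))} (hU : IsOpen U)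
    (hKU : closedBall (0 : EuclideanSpace ℝ (Fin 2)) (ρ + 2 * M) ⊆ U) :
    ∃ G : AmbientIsotopy 𝓘(ℝ, EuclideanSpace ℝ (Fin 2)) (EuclideanSpace ℝ (Fin 2)),
      (∃ C : Set (EuclideanSpace ℝ (Fin 2)), IsCompact C ∧ C ⊆ U ∧ ∀ t, ∀ z ∉ C, G.toFun t z = z) ∧
      ∀ z : EuclideanSpace ℝ (Fin 2), ‖z‖ ≤ ρ → ∀ t ∈ Icc (0 : ℝ) 1,
        G.toFun t z = z + (t * d (z 0)) • EuclideanSpace.single 1 1 := by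
  set Y : ℝ × EuclideanSpace ℝ (Fin 2) → EuclideanSpace ℝ (Fin 2) := fun p ↦ d (p.2 0) • EuclideanSpace.single 1 1 with hY
  have hYs : ContDiff ℝ ∞ Y :=
    ((hd.comp ((contDiff_apply 0).comp contDiff_snd)).smul contDiff_const)
  set c : closedBall (0 : EuclideanSpace ℝ (Fin 2)) ρ → ℝ → EuclideanSpace ℝ (Fin 2) :=
    fun z t ↦ (z : EuclideanSpace ℝ (Fin 2)) + (t * d ((z : EuclideanSpace ℝ (Fin 2)) 0)) • EuclideanSpace.single 1 1 with hc
  have hc0 : ∀ (z : closedBall (0 : EuclideanSpace ℝ (Fin 2)) ρ) (t : ℝ), c z t 0 = (z : EuclideanSpace ℝ (Fin 2)) 0 := fun z t ↦ by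
    simp [c]
  have hderiv : ∀ (z : closedBall (0 : EuclideanSpace ℝ (Fin 2)) ρ), ∀ t ∈ Ioo (-1 : ℝ) 2,
      HasDerivAt (c z) (Y (t, c z t)) t := by
    intro z t _
    have h1 : HasDerivAt (fun t : ℝ ↦ t * d ((z : EuclideanSpace ℝ (Fin 2)) 0)) (d ((z : EuclideanSpace ℝ (Fin 2)) 0)) t := by
      simpa using (hasDerivAt_id t).mul_const (d ((z : EuclideanSpace ℝ (Fin 2)) 0))
    have h2 := (h1.smul_const (EuclideanSpace.single (1 : Fin 2) (1 : ℝ))).const_add (z : EuclideanSpace ℝ (Fin 2))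
    have hY' : Y (t, c z t) = d ((z : EuclideanSpace ℝ (Fin 2)) 0) • EuclideanSpace.single 1 1 := by
      simp only [hY, hc0]
    rw [hY']
    exact h2
  have htrack : ∀ (z : closedBall (0 : EuclideanSpace ℝ (Fin 2)) ρ), ∀ t ∈ Ioo (-1 : ℝ) 2,
      c z t ∈ closedBall (0 : EuclideanSpace ℝ (Fin 2)) (ρ + 2 * M) := by
    intro z t ht
    have hz : ‖(z : EuclideanSpace ℝ (Fin 2))‖ ≤ ρ := mem_closedBall_zero_iff.1 z.2
    rw [mem_closedBall_zero_iff]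
    calc ‖c z t‖ ≤ ‖(z : EuclideanSpace ℝ (Fin 2))‖ + ‖(t * d ((z : EuclideanSpace ℝ (Fin 2)) 0)) • EuclideanSpace.single (1 : Fin 2) (1 : ℝ)‖ :=
          norm_add_le _ _
      _ = ‖(z : EuclideanSpace ℝ (Fin 2))‖ + |t| * |d ((z : EuclideanSpace ℝ (Fin 2)) 0)| := by
          rw [norm_smul, norm_single_one, mul_one, Real.norm_eq_abs, abs_mul]
      _ ≤ ρ + 2 * M := by
          have ht2 : |t| ≤ 2 := abs_le.2 ⟨by linarith [ht.1], ht.2.le⟩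
          have := hM ((z : EuclideanSpace ℝ (Fin 2)) 0)
          nlinarith [abs_nonneg t, abs_nonneg (d ((z : EuclideanSpace ℝ (Fin 2)) 0))]
  obtain ⟨G, hGC, hGc⟩ := exists_ambientIsotopy_of_hasDerivAt hYs hderiv
    (isCompact_closedBall (0 : EuclideanSpace ℝ (Fin 2)) (ρ + 2 * M)) hU hKU htrack
  refine ⟨G, hGC, fun z hz t ht ↦ ?_⟩
  have := hGc ⟨z, mem_closedBall_zero_iff.2 hz⟩ t ht
  simpa [c] using this

/-! ## The angular twist

The flow of the quadratic field `Y(z) = c ⟪z, e₁⟫ • J z` (`J (x, y) = (-y, x)`) preserves every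
circle `‖z‖ = r` and restricts to it as the flow of `u̇ = c r sin u` in the angle `u` from the
positive `x`-axis, whose time-`t` map is `tan (u/2) ↦ e^{c r t} tan (u/2)`: in Cartesian form the
point `r (a, b)` (`a² + b² = 1`) travels along
`t ↦ r ((1 + a) - λ² (1 - a), 2 λ b) / ((1 + a) + λ² (1 - a))`, `λ = e^{c r t}`. The two points
`(± r, 0)` are fixed; for `c > 0` every other point drifts towards `(-r, 0)`, compressing any arc
of the circle avoiding `(r, 0)` into the left half plane — the chart in which the two arcs of the
handle-slide sweep become graphs over the vertical coordinate. -/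

/-- The denominator `N = (1 + a) + μ (1 - a)` of the twist formulas is positive for `μ > 0` and
`a² ≤ 1`. [folklore] -/
theorem twist_denom_pos {a μ : ℝ} (hμ : 0 < μ) (ha : a ^ 2 ≤ 1) :
    0 < (1 + a) + μ * (1 - a) := by
  have ha1 : -1 ≤ a ∧ a ≤ 1 := abs_le.1 ((sq_le_one_iff_abs_le_one a).1 ha)
  rcases eq_or_lt_of_le ha1.1 with h | h
  · rw [← h]; nlinarith
  · nlinarith

/-- The twist formulas stay on the unit circle: `A² + B² = 1`. [folklore] -/
theorem twist_sq_add_sq {a b lam : ℝ} (hab : a ^ 2 + b ^ 2 = 1) (hN : (1 + a) + lam ^ 2 * (1 - a) ≠ 0) :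
    (((1 + a) - lam ^ 2 * (1 - a)) / ((1 + a) + lam ^ 2 * (1 - a))) ^ 2 +
      (2 * lam * b / ((1 + a) + lam ^ 2 * (1 - a))) ^ 2 = 1 := by
  rw [div_pow, div_pow, ← add_div, div_eq_one_iff_eq (pow_ne_zero 2 hN)]
  have hb : b ^ 2 = 1 - a ^ 2 := by linarith
  nlinarith [hb]

/-- The norm of a point of the plane given by its two coordinates. [folklore] -/
theorem norm_smul_single_add_smul_single (x y : ℝ) :
    ‖x • EuclideanSpace.single (0 : Fin 2) (1 : ℝ) + y • EuclideanSpace.single (1 : Fin 2) (1 : ℝ)‖ =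
      Real.sqrt (x ^ 2 + y ^ 2) := by
  rw [EuclideanSpace.norm_eq, Fin.sum_univ_two]
  congr 1
  simp [sq_abs]

/-- **The angular twist.** For `c : ℝ` and a radius `r₃`: for every open `U ⊇ B̄(0, r₃)` there
is an ambient isotopy `G` of the plane, stationary off a compact subset of `U`, whose stages act
on the disc of radius `r₃` as the flow of `Y(z) = c ⟪z, e₁⟫ • J z`: for `0 ≤ r ≤ r₃`,
`a² + b² = 1` and `0 ≤ t ≤ 1`,
`G t (r a, r b) = r ((1 + a) - λ² (1 - a), 2 λ b) / ((1 + a) + λ² (1 - a))`, `λ = e^{c r t}` (on the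
circle of radius `r` this is `tan (u/2) ↦ e^{c r t} tan (u/2)` in the angle `u`). Hirsch (1976),
Ch. 8 §1, Thms. 1.2–1.3 (cut the field off near the disc and integrate; the trajectories are
checked by differentiating the formula). [cite: HirschDT1976, Ch. 8 §1, Thm. 1.3] -/
theorem exists_ambientIsotopy_angularTwist (c : ℝ) {r₃ : ℝ} {U : Set (EuclideanSpace ℝ (Fin 2))}
    (hU : IsOpen U) (hKU : closedBall (0 : EuclideanSpace ℝ (Fin 2)) r₃ ⊆ U) :
    ∃ G : AmbientIsotopy 𝓘(ℝ, EuclideanSpace ℝ (Fin 2)) (EuclideanSpace ℝ (Fin 2)),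
      (∃ C : Set (EuclideanSpace ℝ (Fin 2)), IsCompact C ∧ C ⊆ U ∧ ∀ t, ∀ z ∉ C, G.toFun t z = z) ∧
      ∀ (r a b : ℝ), 0 ≤ r → r ≤ r₃ → a ^ 2 + b ^ 2 = 1 → ∀ t ∈ Icc (0 : ℝ) 1,
        G.toFun t ((r * a) • EuclideanSpace.single 0 1 + (r * b) • EuclideanSpace.single 1 1) =
          (r * (((1 + a) - Real.exp (c * r * t) ^ 2 * (1 - a)) /
              ((1 + a) + Real.exp (c * r * t) ^ 2 * (1 - a)))) • EuclideanSpace.single 0 1 +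
          (r * (2 * Real.exp (c * r * t) * b /
              ((1 + a) + Real.exp (c * r * t) ^ 2 * (1 - a)))) • EuclideanSpace.single 1 1 := by
  set E0 : EuclideanSpace ℝ (Fin 2) := EuclideanSpace.single 0 1 with hE0
  set E1 : EuclideanSpace ℝ (Fin 2) := EuclideanSpace.single 1 1 with hE1
  have hc0 : ∀ x y : ℝ, (x • E0 + y • E1) 0 = x := fun x y ↦ by simp [E0, E1]
  have hc1 : ∀ x y : ℝ, (x • E0 + y • E1) 1 = y := fun x y ↦ by simp [E0, E1]
  -- the field `Y (z) = c z₁ • (-z₁, z₀)`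
  set Y : ℝ × EuclideanSpace ℝ (Fin 2) → EuclideanSpace ℝ (Fin 2) := fun p ↦ (-(c * p.2 1 * p.2 1)) • E0 + (c * p.2 1 * p.2 0) • E1
    with hY
  have hYs : ContDiff ℝ ∞ Y := by
    have h0 : ContDiff ℝ ∞ fun p : ℝ × EuclideanSpace ℝ (Fin 2) ↦ p.2 0 := (contDiff_apply 0).comp contDiff_snd
    have h1 : ContDiff ℝ ∞ fun p : ℝ × EuclideanSpace ℝ (Fin 2) ↦ p.2 1 := (contDiff_apply 1).comp contDiff_snd
    exact (((contDiff_const.mul h1).mul h1).neg.smul contDiff_const).add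
      (((contDiff_const.mul h1).mul h0).smul contDiff_const)
  -- index set and trajectories
  set ι := {q : ℝ × ℝ × ℝ // 0 ≤ q.1 ∧ q.1 ≤ r₃ ∧ q.2.1 ^ 2 + q.2.2 ^ 2 = 1} with hι
  -- the formulas, as functions of `(r, a, b, t)`
  set Nf : ℝ → ℝ → ℝ → ℝ := fun r a t ↦ (1 + a) + Real.exp (c * r * t) ^ 2 * (1 - a) with hNf
  set Af : ℝ → ℝ → ℝ → ℝ := fun r a t ↦ ((1 + a) - Real.exp (c * r * t) ^ 2 * (1 - a)) / Nf r a t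
    with hAf
  set Bf : ℝ → ℝ → ℝ → ℝ → ℝ := fun r a b t ↦ 2 * Real.exp (c * r * t) * b / Nf r a t with hBf
  set γ : ι → ℝ → EuclideanSpace ℝ (Fin 2) := fun q t ↦ (q.1.1 * Af q.1.1 q.1.2.1 t) • E0 + (q.1.1 * Bf q.1.1 q.1.2.1 q.1.2.2 t) • E1
    with hγ
  have hN_pos : ∀ (q : ι) (t : ℝ), 0 < Nf q.1.1 q.1.2.1 t := fun q t ↦ by
    have hab := q.2.2.2
    exact twist_denom_pos (pow_pos (Real.exp_pos _) 2) (by nlinarith [sq_nonneg q.1.2.2])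
  -- derivatives of the formulas
  have hderivAB : ∀ (q : ι) (t : ℝ),
      HasDerivAt (fun t ↦ Af q.1.1 q.1.2.1 t)
        (-(c * q.1.1) * (Bf q.1.1 q.1.2.1 q.1.2.2 t) ^ 2) t ∧
      HasDerivAt (fun t ↦ Bf q.1.1 q.1.2.1 q.1.2.2 t)
        ((c * q.1.1) * Af q.1.1 q.1.2.1 t * Bf q.1.1 q.1.2.1 q.1.2.2 t) t := by
    intro q t
    rcases q with ⟨⟨r, a, b⟩, hr, hr3, hab⟩
    show HasDerivAt (fun t ↦ Af r a t) (-(c * r) * (Bf r a b t) ^ 2) t ∧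
      HasDerivAt (fun t ↦ Bf r a b t) ((c * r) * Af r a t * Bf r a b t) t
    set k : ℝ := c * r with hk
    set L : ℝ := Real.exp (k * t) with hL
    -- `λ(t) = exp (k t)`, `λ' = k λ`, `(λ²)' = 2 k λ²`
    have hlam : HasDerivAt (fun t ↦ Real.exp (k * t)) (k * L) t := by
      have h := ((hasDerivAt_id t).const_mul k).exp
      simp only [id_eq, mul_one] at h
      rw [hL, mul_comm (Real.exp (k * t)) k] at *
      exact h
    have hlam2 : HasDerivAt (fun t ↦ Real.exp (k * t) ^ 2) (2 * k * L ^ 2) t := by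
      have h := hlam.pow 2
      refine h.congr_deriv ?_
      simp only [Nat.cast_ofNat]
      ring
    have hN : HasDerivAt (fun t ↦ Nf r a t) (2 * k * L ^ 2 * (1 - a)) t := by
      have := (hlam2.mul_const (1 - a)).const_add (1 + a)
      simpa [hNf, hk] using this
    have hnum : HasDerivAt (fun t ↦ (1 + a) - Real.exp (k * t) ^ 2 * (1 - a))
        (-(2 * k * L ^ 2 * (1 - a))) t := by
      have := (hlam2.mul_const (1 - a)).const_sub (1 + a)
      simpa using this
    have hnumB : HasDerivAt (fun t ↦ 2 * Real.exp (k * t) * b) (2 * (k * L) * b) t := by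
      have := (hlam.const_mul 2).mul_const b
      simpa using this
    have hNt : Nf r a t = (1 + a) + L ^ 2 * (1 - a) := by simp [hNf, hL, hk]
    have ha2 : a ^ 2 ≤ 1 := by nlinarith [sq_nonneg b]
    have hN0' : (1 + a) + L ^ 2 * (1 - a) ≠ 0 :=
      (twist_denom_pos (pow_pos (Real.exp_pos (k * t)) 2) ha2).ne'
    have hN0 : Nf r a t ≠ 0 := hNt ▸ hN0'
    have hb : b ^ 2 = 1 - a ^ 2 := by linarith
    have hAval : Af r a t = ((1 + a) - L ^ 2 * (1 - a)) / ((1 + a) + L ^ 2 * (1 - a)) := by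
      simp [hAf, hNf, hL, hk]
    have hBval : Bf r a b t = 2 * L * b / ((1 + a) + L ^ 2 * (1 - a)) := by
      simp [hBf, hNf, hL, hk]
    have hAfun : (fun t ↦ Af r a t) =
        (fun t ↦ (1 + a) - Real.exp (k * t) ^ 2 * (1 - a)) / fun t ↦ Nf r a t := by
      funext s; simp [hAf, hk]
    have hBfun : (fun t ↦ Bf r a b t) = (fun t ↦ 2 * Real.exp (k * t) * b) / fun t ↦ Nf r a t := by
      funext s; simp [hBf, hk]
    have hB2 : (Bf r a b t) ^ 2 = 4 * L ^ 2 * (1 - a ^ 2) / ((1 + a) + L ^ 2 * (1 - a)) ^ 2 := by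
      rw [hBval, div_pow]
      congr 1
      rw [mul_pow, mul_pow, hb]
      ring
    constructor
    · rw [hAfun]
      refine (hnum.div hN hN0).congr_deriv ?_
      rw [hNt, hB2]
      field_simp
      ring
    · rw [hBfun]
      refine (hnumB.div hN hN0).congr_deriv ?_
      rw [hNt, hAval, hBval]
      field_simp
      ring
  -- the trajectories solve the field
  have hderiv : ∀ (q : ι), ∀ t ∈ Ioo (-1 : ℝ) 2, HasDerivAt (γ q) (Y (t, γ q t)) t := by
    intro q t _
    obtain ⟨hA, hB⟩ := hderivAB q t
    have h := ((hA.const_mul q.1.1).smul_const E0).add ((hB.const_mul q.1.1).smul_const E1)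
    have hYval : Y (t, γ q t) =
        (q.1.1 * (-(c * q.1.1) * (Bf q.1.1 q.1.2.1 q.1.2.2 t) ^ 2)) • E0 +
        (q.1.1 * ((c * q.1.1) * Af q.1.1 q.1.2.1 t * Bf q.1.1 q.1.2.1 q.1.2.2 t)) • E1 := by
      simp only [hY, hγ, hc0, hc1]
      congr 1 <;> congr 1 <;> ring
    rw [hYval]
    exact h
  -- the tracks stay in the ball of radius `r₃`
  have htrack : ∀ (q : ι), ∀ t ∈ Ioo (-1 : ℝ) 2, γ q t ∈ closedBall (0 : EuclideanSpace ℝ (Fin 2)) r₃ := by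
    intro q t _
    rcases q with ⟨⟨r, a, b⟩, hr, hr3, hab⟩
    rw [mem_closedBall_zero_iff]
    simp only [hγ]
    rw [norm_smul_single_add_smul_single]
    have hN0 : Nf r a t ≠ 0 := (hN_pos ⟨(r, a, b), hr, hr3, hab⟩ t).ne'
    have h1 : (Af r a t) ^ 2 + (Bf r a b t) ^ 2 = 1 := by
      simp only [hAf, hBf, hNf] at hN0 ⊢
      exact twist_sq_add_sq hab hN0
    have : (r * Af r a t) ^ 2 + (r * Bf r a b t) ^ 2 = r ^ 2 := by nlinarith [h1]
    rw [this, Real.sqrt_sq hr]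
    exact hr3
  obtain ⟨G, hGC, hGc⟩ := exists_ambientIsotopy_of_hasDerivAt hYs hderiv
    (isCompact_closedBall (0 : EuclideanSpace ℝ (Fin 2)) r₃) hU hKU htrack
  refine ⟨G, hGC, fun r a b hr hr3 hab t ht ↦ ?_⟩
  have h := hGc ⟨(r, a, b), hr, hr3, hab⟩ t ht
  have h0 : γ ⟨(r, a, b), hr, hr3, hab⟩ 0 = (r * a) • E0 + (r * b) • E1 := by
    have hN1 : Nf r a 0 = 2 := by simp [hNf]; ring
    simp only [hγ, hAf, hBf, hN1]
    simp only [mul_zero, Real.exp_zero, one_pow, one_mul, mul_one]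
    congr 1 <;> congr 1 <;> ring
  rw [h0] at h
  rw [h]

/-- **The angular twist preserves the norm** on the disc of radius `r₃`. [folklore] -/
theorem norm_angularTwist_formula {r a b lam : ℝ} (hr : 0 ≤ r) (hab : a ^ 2 + b ^ 2 = 1)
    (hN : (1 + a) + lam ^ 2 * (1 - a) ≠ 0) :
    ‖(r * (((1 + a) - lam ^ 2 * (1 - a)) / ((1 + a) + lam ^ 2 * (1 - a)))) •
        EuclideanSpace.single (0 : Fin 2) (1 : ℝ) +
      (r * (2 * lam * b / ((1 + a) + lam ^ 2 * (1 - a)))) •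
        EuclideanSpace.single (1 : Fin 2) (1 : ℝ)‖ = r := by
  rw [norm_smul_single_add_smul_single]
  have h1 := twist_sq_add_sq hab hN
  have : (r * (((1 + a) - lam ^ 2 * (1 - a)) / ((1 + a) + lam ^ 2 * (1 - a)))) ^ 2 +
      (r * (2 * lam * b / ((1 + a) + lam ^ 2 * (1 - a)))) ^ 2 = r ^ 2 := by nlinarith [h1]
  rw [this, Real.sqrt_sq hr]

/-- **The angular twist fixes the horizontal axis**: the formulas give `(r, 0) ↦ (r, 0)` and
`(-r, 0) ↦ (-r, 0)` (`b = 0`, `a = ±1`). [folklore] -/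
theorem angularTwist_formula_axis (lam : ℝ) (hlam : lam ≠ 0) :
    (((1 + (1 : ℝ)) - lam ^ 2 * (1 - 1)) / ((1 + 1) + lam ^ 2 * (1 - 1)) = 1 ∧
      2 * lam * (0 : ℝ) / ((1 + 1) + lam ^ 2 * (1 - 1)) = 0) ∧
    (((1 + (-1 : ℝ)) - lam ^ 2 * (1 - -1)) / ((1 + -1) + lam ^ 2 * (1 - -1)) = -1 ∧
      2 * lam * (0 : ℝ) / ((1 + -1) + lam ^ 2 * (1 - -1)) = 0) := by
  have h2 : lam ^ 2 ≠ 0 := pow_ne_zero 2 hlam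
  refine ⟨⟨by norm_num, by norm_num⟩, ?_, by norm_num⟩
  field_simp
  ring

end SlideSweep

end Literature.Topology.FourManifolds
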